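import Summits.CriticalPhenomena.PercolationContinuityZ3.Theorems.PercNearOneGluingNoHeavyLowerTailThreePointCPIClusterSwapCount
import HarnessLib

/-!
# Disjoint occurrence `Y □ D` is "open reach avoiding the other closed cluster"; Reimer's inequality for `(Y, D)` is exact

Crux `stmt-CriticalPhenomena-4575`, route `PercNearOneGluingNoHeavy`, 3-point CPI₂ fibre line (facecert gen 28; memo
`prim-l12/prim-facecert/FINDING-gen28-CLUSTER-SWAP.md`).  Notation of `…ThreePointCPIClusterSwap[Count]`: `Q_t(z)` closed
cluster of `t`, `U_s(z)` open reach of `s` avoiding `V(Q_b(z))` (`UReach ends s b z`), `D = {s ∉ Q_b}`, `Y = {c ↔ {s,b} open}`,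
`A₃ = #{s ↮ b open, c ↔ {s,b} open}`, and `Y □ D` the disjoint occurrence of `…ThreePointCPIReimer`
(`∃ K, [z]_K ⊆ Y ∧ [z]_{Kᶜ} ⊆ D`).

* `box_iff_ureach` — **CHARACTERISATION** (facecert gen-26 memo §0(6), now in the kernel): for `z ∈ D`,
  `z ∈ Y □ D ⟺ c ∈ U_s(z) ∪ U_b(z)`.  (⇐: `K` = all open labels avoiding `V(Q_b)`; a closed-or-`K` walk from `b` never
  leaves `V(Q_b)`.  ⇒: the `K`-open `c–t` walk cannot meet `V(Q_{t'})`, else `t' ↔ t` by closed-or-`K` labels.)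
* `card_box_eq` — `#(Y □ D) = #{D ∧ (c ∈ U_s ∨ c ∈ U_b)}`.
* `card_A3_eq_card_box_add` — **EXACT REIMER**: `A₃ = #(Y □ D) + #{D ∧ c ∈ U_s ∧ c ∈ U_b}`: Reimer's inequality
  `#(Y □ D) ≤ A₃` (`…ThreePointCPIReimer.card_box_le`, Reimer 2000 Thm. 1.2 applied to `(Y, D)`) holds with defect exactly the
  number of configurations in `D` in which the port `c` reaches BOTH terminals by open paths avoiding the other terminal's
  closed cluster; consequently `2A₃ − B₃ = #{D, c ∈ U_s∩U_b} + (X4 + X5 − X1)` in the cells of `…ThreePointCPIReimer`.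
-/

namespace Summit.CriticalPhenomena.PercolationContinuityZ3.Theorems.ThreePointCPIClusterSwap

open Finset Literature.Probability.Percolation

variable {V α : Type*}

section Box

variable (ends : α → Sym2 V) (s b c : V)

/-- A walk in the open graph of a configuration `x` all of whose open labels are `y`-closed is a walk of the closed
graph of `y`. [this work] -/
theorem creach_of_walk (x y : α → Bool) (H : ∀ a, x a = true → y a = false) {u v : V}
    (p : (openGraph (labelledOpen ends x)).Walk u v) : CReach ends y u v := by
  induction p with
  | nil => exact SimpleGraph.Reachable.refl _
  | @cons u w v hadj p ih =>
    rw [openGraph_adj] at hadj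
    obtain ⟨⟨a, ha, hends⟩, huw⟩ := hadj
    refine SimpleGraph.Reachable.trans (SimpleGraph.Adj.reachable ?_) ih
    rw [openGraph_adj]
    exact ⟨⟨a, by show (!y a) = true; rw [H a ha]; rfl, hends⟩, huw⟩

/-- **`Y □ D` implies open reach avoiding the other closed cluster.** If `K` certifies `Y` on `z` (every `w` agreeing
with `z` on `K` has `c ↔ t`) and `Kᶜ` certifies `D`, then `c ∈ U_s(z)` or `c ∈ U_b(z)`. [this work] -/
theorem ureach_of_box (z : α → Bool) (K : Finset α)
    (hY : ∀ w : α → Bool, (∀ i ∈ K, w i = z i) →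
      ((openGraph (labelledOpen ends w)).Reachable c s ∨ (openGraph (labelledOpen ends w)).Reachable c b))
    (hD : ∀ w : α → Bool, (∀ i, i ∉ K → w i = z i) →
      ¬ (openGraph (labelledOpen ends fun a => !w a)).Reachable s b) :
    UReach ends s b z c ∨ UReach ends b s z c := by
  classical
  -- w₁ := z on K, closed off K;  w₂ := z off K, closed on K
  set w₁ : α → Bool := fun a => if a ∈ K then z a else false with hw₁
  set w₂ : α → Bool := fun a => if a ∈ K then false else z a with hw₂
  have h1 : ∀ a, w₁ a = true → a ∈ K ∧ z a = true := by
    intro a ha; by_cases hK : a ∈ K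
    · exact ⟨hK, by simpa [hw₁, hK] using ha⟩
    · simp [hw₁, hK] at ha
  have hY₁ := hY w₁ (fun i hi => by simp [hw₁, hi])
  have hD₂ := hD w₂ (fun i hi => by simp [hw₂, hi])
  -- every w₁-open label and every z-closed label is w₂-closed
  have h12 : ∀ a, w₁ a = true → w₂ a = false := fun a ha => by simp [hw₂, (h1 a ha).1]
  have hz2 : ∀ a, z a = false → w₂ a = false := by
    intro a ha; by_cases hK : a ∈ K <;> simp [hw₂, hK, ha]
  -- a `w₁`-open walk all of whose vertices avoid `V(Q_{t'}(z))` is a walk of the avoiding graph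
  have key : ∀ (t' : V) {u v : V} (p : (openGraph (labelledOpen ends w₁)).Walk u v),
      (∀ x ∈ p.support, ¬ CReach ends z t' x) → (openGraph (avoidQ ends t' z)).Reachable u v := by
    intro t' u v p
    induction p with
    | nil => exact fun _ => SimpleGraph.Reachable.refl _
    | @cons u x v hadj p ih =>
      intro hsupp
      rw [SimpleGraph.Walk.support_cons] at hsupp
      have hu : ¬ CReach ends z t' u := hsupp u (List.mem_cons_self)
      have hx : ¬ CReach ends z t' x := hsupp x (List.mem_cons_of_mem _ p.start_mem_support)
      rw [openGraph_adj] at hadj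
      obtain ⟨⟨a, ha, hends⟩, hux⟩ := hadj
      have step : (openGraph (avoidQ ends t' z)).Adj u x := by
        rw [openGraph_adj]
        refine ⟨⟨⟨a, (h1 a ha).2, hends⟩, ?_⟩, hux⟩
        intro y hy
        rw [Sym2.mem_iff] at hy
        rcases hy with rfl | rfl
        exacts [hu, hx]
      exact step.reachable.trans (ih fun y hy => hsupp y (List.mem_cons_of_mem _ hy))
  -- every vertex with a `w₁`-open walk to `t` lies outside `V(Q_{t'}(z))` when `t' ↮ t` in the closed graph of `w₂`
  have out : ∀ (t t' : V), ¬ CReach ends w₂ t' t → ∀ {x : V},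
      (openGraph (labelledOpen ends w₁)).Reachable x t → ¬ CReach ends z t' x := by
    rintro t t' hD' x ⟨q⟩ hx
    apply hD'
    have h1' : CReach ends w₂ x t := creach_of_walk ends w₁ w₂ h12 q
    have h2' : CReach ends w₂ t' x := by
      obtain ⟨r⟩ := hx
      exact creach_of_walk ends (fun a => !z a) w₂ (fun a ha => hz2 a (by simpa using ha)) r
    exact h2'.trans h1'
  have main : ∀ (t t' : V), ¬ CReach ends w₂ t' t →
      (openGraph (labelledOpen ends w₁)).Reachable c t → UReach ends t t' z c := by
    rintro t t' hD' ⟨p⟩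
    refine (key t' p fun x hx => out t t' hD' ⟨p.dropUntil x hx⟩).symm
  rcases hY₁ with hs | hb
  · exact Or.inl (main s b (fun h => hD₂ h.symm) hs)
  · exact Or.inr (main b s (fun h => hD₂ h) hb)

/-- **Open reach avoiding the other closed cluster implies `Y □ D`.** If `z ∈ D` and `c ∈ U_s(z)` then
`K :=` the set of open labels with no endpoint in `V(Q_b(z))` certifies `Y` while `Kᶜ` certifies `D`. [this work] -/
theorem box_of_ureach [Fintype α] (z : α → Bool) (hDz : ¬ CReach ends z b s) (h : UReach ends s b z c) :
    ∃ K : Finset α,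
      (∀ w : α → Bool, (∀ i ∈ K, w i = z i) →
        ((openGraph (labelledOpen ends w)).Reachable c s ∨ (openGraph (labelledOpen ends w)).Reachable c b)) ∧
      (∀ w : α → Bool, (∀ i, i ∉ K → w i = z i) →
        ¬ (openGraph (labelledOpen ends fun a => !w a)).Reachable s b) := by
  classical
  refine ⟨univ.filter fun a => z a = true ∧ ∀ v, v ∈ ends a → ¬ CReach ends z b v, ?_, ?_⟩
  · -- Y: the avoiding path is open in w
    intro w hw
    left
    obtain ⟨p⟩ := h
    refine SimpleGraph.Reachable.symm ⟨p.transfer (openGraph (labelledOpen ends w)) fun e he => ?_⟩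
    have heG := p.edges_subset_edgeSet he
    rw [openGraph, SimpleGraph.edgeSet_fromEdgeSet] at heG ⊢
    obtain ⟨⟨⟨a, ha, hends⟩, havoid⟩, hdiag⟩ := heG
    refine ⟨⟨a, ?_, hends⟩, hdiag⟩
    have hK : a ∈ univ.filter fun a => z a = true ∧ ∀ v, v ∈ ends a → ¬ CReach ends z b v := by
      simp only [mem_filter, mem_univ, true_and]
      exact ⟨ha, fun v hv => havoid v (hends ▸ hv)⟩
    rw [hw a hK, ha]
  · -- D: a w-closed walk from b never leaves V(Q_b(z))
    intro w hw hsb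
    have stay : ∀ {u v : V} (q : (openGraph (labelledOpen ends fun a => !w a)).Walk u v),
        CReach ends z b u → CReach ends z b v := by
      intro u v q
      induction q with
      | nil => exact id
      | @cons u x v hadj q ih =>
        intro hu
        rw [openGraph_adj] at hadj
        obtain ⟨⟨a, ha, hends⟩, hux⟩ := hadj
        have hwa : w a = false := by simpa using ha
        by_cases hK : a ∈ univ.filter fun a => z a = true ∧ ∀ v, v ∈ ends a → ¬ CReach ends z b v
        · simp only [mem_filter, mem_univ, true_and] at hK
          exact absurd hu (hK.2 u (by rw [hends]; exact Sym2.mem_mk_left _ _))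
        · have hza : z a = false := by rw [← hw a hK, hwa]
          exact ih (creach_step ends b z hza hends hu)
    obtain ⟨q⟩ := hsb
    exact hDz (stay q.reverse (creach_self ends b z))

/-- **Characterisation of disjoint occurrence.** For `z ∈ D`: `z ∈ Y □ D ⟺ c ∈ U_s(z) ∨ c ∈ U_b(z)` (facecert gen-26
memo §0(6)). [this work] -/
theorem box_iff_ureach [Fintype α] (z : α → Bool) (hDz : ¬ CReach ends z b s) :
    (∃ K : Finset α,
      (∀ w : α → Bool, (∀ i ∈ K, w i = z i) →
        ((openGraph (labelledOpen ends w)).Reachable c s ∨ (openGraph (labelledOpen ends w)).Reachable c b)) ∧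
      (∀ w : α → Bool, (∀ i, i ∉ K → w i = z i) →
        ¬ (openGraph (labelledOpen ends fun a => !w a)).Reachable s b)) ↔
    (UReach ends s b z c ∨ UReach ends b s z c) := by
  constructor
  · rintro ⟨K, hY, hD⟩
    exact ureach_of_box ends s b c z K hY hD
  · rintro (h | h)
    · exact box_of_ureach ends s b c z hDz h
    · obtain ⟨K, hY, hD⟩ := box_of_ureach ends b s c z (fun h' => hDz h'.symm) h
      exact ⟨K, fun w hw => (hY w hw).symm, fun w hw h' => hD w hw h'.symm⟩

end Box

section Count

variable [Fintype α] [DecidableEq α] (ends : α → Sym2 V) (s b c : V)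

open Classical in
/-- **`#(Y □ D)` inside `D`.** `#{z : Y □ D} = #{z ∈ D : c ∈ U_s(z) ∨ c ∈ U_b(z)}`. [this work] -/
theorem card_box_eq :
    (univ.filter fun z : α → Bool => ∃ K : Finset α,
        (∀ w : α → Bool, (∀ i ∈ K, w i = z i) →
          ((openGraph (labelledOpen ends w)).Reachable c s ∨
            (openGraph (labelledOpen ends w)).Reachable c b)) ∧
        (∀ w : α → Bool, (∀ i, i ∉ K → w i = z i) →
          ¬ (openGraph (labelledOpen ends fun a => !w a)).Reachable s b)).card =
    (univ.filter fun z : α → Bool => ¬ CReach ends z b s ∧ (UReach ends s b z c ∨ UReach ends b s z c)).card := by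
  refine congrArg Finset.card (Finset.filter_congr fun z _ => ?_)
  constructor
  · rintro ⟨K, hY, hD⟩
    have hDz : ¬ CReach ends z b s := fun h => hD z (fun _ _ => rfl) h.symm
    exact ⟨hDz, (box_iff_ureach ends s b c z hDz).1 ⟨K, hY, hD⟩⟩
  · rintro ⟨hDz, h⟩
    exact (box_iff_ureach ends s b c z hDz).2 h

open Classical in
/-- **Reimer's inequality for `(Y, D)` is exact.** `A₃ = #(Y □ D) + #{z ∈ D : c ∈ U_s(z) ∧ c ∈ U_b(z)}` for every finite
multigraph and all `s, b, c`: the defect in `#(Y □ D) ≤ A₃` (`…ThreePointCPIReimer.card_box_le`) is exactly the number of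
configurations with `s ↮ b` closed in which `c` reaches both terminals by open paths avoiding the other terminal's closed
cluster. [this work] -/
theorem card_A3_eq_card_box_add :
    (univ.filter fun z : α → Bool =>
        ¬ (openGraph (labelledOpen ends z)).Reachable s b ∧
        ((openGraph (labelledOpen ends z)).Reachable c s ∨
          (openGraph (labelledOpen ends z)).Reachable c b)).card =
    (univ.filter fun z : α → Bool => ∃ K : Finset α,
        (∀ w : α → Bool, (∀ i ∈ K, w i = z i) →
          ((openGraph (labelledOpen ends w)).Reachable c s ∨
            (openGraph (labelledOpen ends w)).Reachable c b)) ∧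
        (∀ w : α → Bool, (∀ i, i ∉ K → w i = z i) →
          ¬ (openGraph (labelledOpen ends fun a => !w a)).Reachable s b)).card +
    (univ.filter fun z : α → Bool => ¬ CReach ends z b s ∧ UReach ends s b z c ∧ UReach ends b s z c).card := by
  rw [card_A3_eq_card_D_ureach_add, card_box_eq]
  -- #{D∧U_s} + #{D∧U_b} = #{D∧(U_s∨U_b)} + #{D∧U_s∧U_b}
  have h1 : (univ.filter fun z : α → Bool => ¬ CReach ends z b s ∧ (UReach ends s b z c ∨ UReach ends b s z c)) =
      (univ.filter fun z : α → Bool => ¬ CReach ends z b s ∧ UReach ends s b z c) ∪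
        (univ.filter fun z : α → Bool => ¬ CReach ends z b s ∧ UReach ends b s z c) := by
    ext z; simp only [mem_filter, mem_univ, true_and, mem_union]; tauto
  have h2 : (univ.filter fun z : α → Bool => ¬ CReach ends z b s ∧ UReach ends s b z c ∧ UReach ends b s z c) =
      (univ.filter fun z : α → Bool => ¬ CReach ends z b s ∧ UReach ends s b z c) ∩
        (univ.filter fun z : α → Bool => ¬ CReach ends z b s ∧ UReach ends b s z c) := by
    ext z; simp only [mem_filter, mem_univ, true_and, mem_inter]; tauto
  rw [h1, h2, Finset.card_union_add_card_inter]

end Count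

end Summit.CriticalPhenomena.PercolationContinuityZ3.Theorems.ThreePointCPIClusterSwap
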